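import Summits.CriticalPhenomena.CardyFormulaZ2.Theorems.CardyFlipRussoVoronoiHubFromSmirnovRestrictLocal

/-!
# Stub `void_global_bound` of line `moebius-exact-delaunay-dilation-ward`
# (crux `VoronoiHubFromSmirnov`, stmt-CriticalPhenomena-6433)

The quantitative probability bound behind the no-void event of the BLACK nuclei read at mesh `δ`
over a physical set `Kc ⊆ closedBall 0 ρ₀` (the one-arm route works on this event): under the
two-colour homogeneous Poisson law `lawBW volume`, the probability that some point of `Kc/δ` has
all black nuclei at distance `≥ s` is at most `(12 (ρ₀/δ)/s + 1)² · exp (-π (s/3)²)` for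
`0 < s ≤ 3 ρ₀/δ` (with `s = 6 √|log δ|` this is `O(δ^10)` up to the polynomial prefactor).

Proof.  The event only involves the black half `c.1`, so it is the first-coordinate pullback of
the event `E = {d | ∃ z ∈ Kc, ∀ x ∈ d, s ≤ dist x (z/δ)}`; the black marginal of `lawBW volume`
is `poissonLaw volume` (`rl_lawBW_real_fst`), a genuine Poisson process of Lebesgue intensity
(`isPoissonPointProcess_poissonLaw_volume`).  With `A = (· / δ) '' Kc ⊆ closedBall 0 (ρ₀/δ)` the
event `E` is (contained in) the no-giant-cells event of `poisson_voidNear_disc_le`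
(I. Benjamini, O. Schramm, *Conformal invariance of Voronoi percolation*, Comm. Math. Phys. 197
(1998) 75–107, Lemma 5.5), applied with `ρ = ρ₀/δ`.

No new definitions; tree facts and Mathlib only.
-/

noncomputable section

namespace Summit.CriticalPhenomena.CardyFormulaZ2.Cruxes.VoronoiHubFromSmirnov.MoebiusExactDelaunayDilationWard

open Set MeasureTheory Metric
open Literature.Analysis.FunctionSpaces
open Literature.Probability.RandomPlanarGeometry

/-- A physical set `Kc ⊆ closedBall 0 ρ₀` read at mesh `δ > 0` (configuration coordinates
`z ↦ z/δ`) lies in `closedBall 0 (ρ₀/δ)`. -/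
theorem vg_image_div_subset_closedBall {Kc : Set ℂ} {ρ₀ δ : ℝ} (hδ : 0 < δ)
    (hK : Kc ⊆ closedBall (0 : ℂ) ρ₀) :
    (fun z : ℂ => z / (δ : ℂ)) '' Kc ⊆ closedBall (0 : ℂ) (ρ₀ / δ) := by
  rintro _ ⟨k, hk, rfl⟩
  have hk' := mem_closedBall_zero_iff.1 (hK hk)
  rw [mem_closedBall_zero_iff, norm_div, Complex.norm_of_nonneg hδ.le]
  exact div_le_div_of_nonneg_right hk' hδ.le

/-- The black no-void-failure event over `Kc/δ` (configurations missing the closed `s`-ball around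
some point `z/δ`, `z ∈ Kc`) is contained in the no-giant-cells event of
`poisson_voidNear_disc_le` for `A = (· / δ) '' Kc` (the two sets are in fact equal). -/
theorem vg_event_subset (Kc : Set ℂ) (δ s : ℝ) :
    {d : PointConfig ℂ | ∃ z ∈ Kc, ∀ x ∈ (d : Set ℂ), s ≤ dist x (z / (δ : ℂ))} ⊆
      {d : PointConfig ℂ | ∃ z ∈ (fun z : ℂ => z / (δ : ℂ)) '' Kc, ∀ q ∈ d, s ≤ dist q z} := by
  rintro d ⟨z, hz, hd⟩
  exact ⟨z / (δ : ℂ), mem_image_of_mem _ hz, fun q hq => hd q hq⟩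

/-- **No void over a compact physical set, quantitatively** (Benjamini–Schramm 1998, Lemma 5.5,
read on the black marginal of the two-colour law): for `Kc ⊆ closedBall 0 ρ₀`, `δ > 0` and
`0 < s ≤ 3 ρ₀/δ`, the `lawBW volume`-probability that some `z ∈ Kc` has every black nucleus at
distance `≥ s` from `z/δ` is at most `(12 (ρ₀/δ)/s + 1)² · exp (-π (s/3)²)`. -/
theorem void_global_bound : ∀ (Kc : Set ℂ) (ρ₀ δ s : ℝ), Kc ⊆ Metric.closedBall (0 : ℂ) ρ₀ → 0 < δ → 0 < s → s ≤ 3 * (ρ₀ / δ) → (lawBW (MeasureTheory.volume : MeasureTheory.Measure ℂ)).real {c | ∃ z ∈ Kc, ∀ x ∈ (c.1 : Set ℂ), s ≤ dist x (z / (δ : ℂ))} ≤ (12 * (ρ₀ / δ) / s + 1) ^ 2 * Real.exp (-(Real.pi * (s / 3) ^ 2)) := by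
  intro Kc ρ₀ δ s hK hδ hs hsρ
  haveI := isPoissonPointProcess_poissonLaw_volume.isProbabilityMeasure
  calc (lawBW (volume : Measure ℂ)).real {c : PointConfig ℂ × PointConfig ℂ |
        ∃ z ∈ Kc, ∀ x ∈ (c.1 : Set ℂ), s ≤ dist x (z / (δ : ℂ))}
      = (poissonLaw (volume : Measure ℂ)).real
          {d : PointConfig ℂ | ∃ z ∈ Kc, ∀ x ∈ (d : Set ℂ), s ≤ dist x (z / (δ : ℂ))} :=
        rl_lawBW_real_fst
          {d : PointConfig ℂ | ∃ z ∈ Kc, ∀ x ∈ (d : Set ℂ), s ≤ dist x (z / (δ : ℂ))}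
    _ ≤ (poissonLaw (volume : Measure ℂ)).real
          {d : PointConfig ℂ | ∃ z ∈ (fun z : ℂ => z / (δ : ℂ)) '' Kc, ∀ q ∈ d, s ≤ dist q z} :=
        measureReal_mono (vg_event_subset Kc δ s)
    _ ≤ (12 * (ρ₀ / δ) / s + 1) ^ 2 * Real.exp (-(Real.pi * (s / 3) ^ 2)) :=
        poisson_voidNear_disc_le isPoissonPointProcess_poissonLaw_volume _ (ρ₀ / δ) s hs hsρ
          (vg_image_div_subset_closedBall hδ hK)

end Summit.CriticalPhenomena.CardyFormulaZ2.Cruxes.VoronoiHubFromSmirnov.MoebiusExactDelaunayDilationWard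

end
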